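import Summits.NavierStokesRegularity.NavierStokesRegularity.Theses.SqueezeCycle
import Summits.NavierStokesRegularity.NavierStokesRegularity.Theses.RecurrentProfiles
import Summits.NavierStokesRegularity.NavierStokesRegularity.Theorems.RecurrentProfilesRecurrentReduction
import Summits.NavierStokesRegularity.NavierStokesRegularity.Theorems.SqueezeCycleSingularProfileOfNontrivial
import Literature.Analysis.FluidPDE.LocalTypeI

/-!
# Line `recurrent-singular-bridge` — crux `ExtremalBiaxialitySubcritical` (stmt-NavierStokesRegularity-11609)

Lead copy (prover-line-stmt-NavierStokesRegularity-11609-c1-0, then continuation leads -c2-0, -c3-0, -c4-0, -c5-0, -c6-0, -c7-0, -c8-0, -c9-0, -c10-0, -c11-0, -c12-0, -c13-0, -c14-0, -c15-0, -c16-0, -c17-0, -c18-0, -c19-0, -c20-0 and -c21-0, 2026-08-17) of the strategist line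
(planner-cstrat-stmt-NavierStokesRegularity-11609-0, 2026-08-16; card `Lines/recurrent-singular-bridge.md`).

RESHAPE 2026-08-17 (this lead): STUB 1 `stub_singularProfileOfNontrivial` is CLOSED — it is item
stmt-NavierStokesRegularity-15368, PROVED in tree by
`Summit.NavierStokesRegularity.NavierStokesRegularity.Theorems.squeezeCycle_singularProfileOfNontrivial_proof`
(Theorems/SqueezeCycleSingularProfileOfNontrivial.lean @ 060430ecffcc); the stub is now a one-line
reference to that theorem. The ONLY remaining `sorry` is STUB 2 `stub_recurrentLiouville`
≡ item stmt-NavierStokesRegularity-1589 `RecurrentProfiles.RecurrentLiouville` BY NAME (shared open crux of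
routes RecurrentProfiles and SqueezeCycle; certified in tree ⇔ RecurrentProfiles' target 1588 ⇔
RellichScar 11716 ∧ 11719, `Theorems.recurrentLiouville_iff_rellichScar`).

The crux is Type-I Liouville on the KNSS-mild class `𝒦_C` (tree: `extremalBiaxialitySubcritical_iff_squeezeLiouville`).
LEVER: a member of `𝒦_C` that is not identically zero has a BLOW-DOWN (centred at a point of
non-vanishing, `v_k(x,t) = k·u(x⋆ + kx, k²t)`, `‖v_k(t⋆/k², 0)‖ = k‖u(t⋆,x⋆)‖ → ∞`) whose `L³_loc` limit is
an ORIGIN-SINGULAR Albritton–Barker slab profile with the same rate (A–B 2019 Thm 1.1, reverse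
direction, run inside `𝒦_C`; the class's scaled energies give `𝐈 < ∞` via A–B Lemma 2.6). So the
crux reduces — with the non-singular and non-recurrent cases DISCHARGED, not partitioned off — to
route RecurrentProfiles' reduction (`recurrentReduction_proof`, PROVED) and its one open crux
`RecurrentLiouville` (stmt-NavierStokesRegularity-1589, shared with route SqueezeCycle).

Stubs (2, one closed): `stub_singularProfileOfNontrivial` (= item 15368, CLOSED by the tree theorem) and
`stub_recurrentLiouville` (≡ stmt-1589 BY NAME — shared open crux; it closes only through that item;
leads must NOT wave workers at it from here).
Composition `ExtremalBiaxialitySubcritical_of : <crux>` uses the two stubs BY NAME and the proved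
`recurrentReduction_proof`; it is kernel-checked (pure logic + `fderiv` of the zero slice). Landed
Theorems form of the composition: `Theorems.extremalBiaxialitySubcritical_of_recurrentLiouville`
(Theorems/SqueezeCycleExtremalBiaxialitySubcriticalOfRecurrentLiouville.lean, `--supports` stmt-11609).
-/

set_option linter.dupNamespace false

namespace Summit.NavierStokesRegularity.NavierStokesRegularity.Cruxes.ExtremalBiaxialitySubcritical.RecurrentSingularBridge

/-- STUB 1 (= stmt-NavierStokesRegularity-15368) — CLOSED: a nontrivial member of `𝒦_C`
yields a suitable weak solution on `ℝ³ × (−∞,0)` with weak gradient, `𝐈(ℝ³×ℝ₋) < ∞`, the same rate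
constant and a backward-singular origin — verbatim the hypotheses of `RecurrentProfiles.RecurrentReduction`.
Proved in tree: `Theorems.squeezeCycle_singularProfileOfNontrivial_proof` (its type is the route decl
`Theses.SqueezeCycle.SingularProfileOfNontrivial`, whose body is this signature verbatim).
[cite: AlbrittonBarker2019, Thm 1.1 §3, Lemma 2.2, Prop 2.3, Lemma 2.6; KNSS2009 §4] -/
theorem stub_singularProfileOfNontrivial :
    ∀ (C : ℝ) (u : ℝ → EuclideanSpace ℝ (Fin 3) → EuclideanSpace ℝ (Fin 3)), (ContDiffOn ℝ (⊤ : ℕ∞) (Function.uncurry u) (Set.Iio 0 ×ˢ Set.univ) ∧ (∀ t < 0, Literature.Analysis.FluidPDE.VectorCalculus.IsDivFree (u t)) ∧ (∀ s t : ℝ, s < t → t < 0 → ∀ x, u t x = Literature.Analysis.FluidPDE.heatFlow (u s) (t-s) x - ∫ τ in Set.Ioo s t, ∫ y, ((-(inner ℝ (x-y) (u τ y) / (2*(t-τ)) * Literature.Analysis.UnboundedOperators.heatKernel (t-τ) (x-y))) • u τ y + (∫ σ in Set.Ioi (t-τ), Literature.Analysis.UnboundedOperators.heatKernel σ (x-y)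 / (4*σ^2)) • (inner ℝ (x-y) (u τ y) • u τ y + inner ℝ (u τ y) (u τ y) • (x-y) + inner ℝ (x-y) (u τ y) • u τ y) - ((∫ σ in Set.Ioi (t-τ), Literature.Analysis.UnboundedOperators.heatKernel σ (x-y) / (8*σ^3)) * (inner ℝ (x-y) (u τ y) * inner ℝ (x-y) (u τ y))) • (x-y))) ∧ Literature.Analysis.FluidPDE.HasTypeITimeDecay C u ∧ (∀ (x₀ : EuclideanSpace ℝ (Fin 3)) (t₀ r : ℝ), t₀ ≤ 0 → 0 < r → (∀ t, t₀ - r^2 < t → t < t₀ → r⁻¹ * ∫ x in Metric.ball x₀ r, ‖u t x‖^2 ≤ C) ∧ r⁻¹ * ∫ t in Set.Ioo (t₀ - r^2) t₀, ∫ x in Metric.ball x₀ r, ‖fderiv ℝ (u t) x‖^2 ≤ C)) → (∃ t : ℝ, t < 0 ∧ ∃ x : EuclideanSpace ℝ (Fin 3), u t x ≠ 0) → ∃ (w : ℝ → EuclideanSpace ℝ (Fin 3) → EuclideanSpace ℝ (Fin 3)) (q : ℝ → EuclideanSpace ℝ (Fin 3) → ℝ) (H : ℝ → EuclideanSpace ℝ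 (Fin 3) → EuclideanSpace ℝ (Fin 3) →L[ℝ] EuclideanSpace ℝ (Fin 3)), Literature.Analysis.FluidPDE.IsSuitableWeakSolutionOn (Literature.Analysis.FluidPDE.slab (EuclideanSpace ℝ (Fin 3)) (Set.Iio 0) isOpen_Iio) 1 0 w q ∧ Literature.Analysis.FluidPDE.HasWeakSpatialGradientOn (Literature.Analysis.FluidPDE.slab (EuclideanSpace ℝ (Fin 3)) (Set.Iio 0) isOpen_Iio) w H ∧ Literature.Analysis.FluidPDE.typeIBound (Set.Iio (0 : ℝ) ×ˢ Set.univ) w q H < ⊤ ∧ Literature.Analysis.FluidPDE.HasTypeITimeDecay C w ∧ Literature.Analysis.FluidPDE.IsBackwardSingularPoint w 0 :=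
  Summit.NavierStokesRegularity.NavierStokesRegularity.Theorems.squeezeCycle_singularProfileOfNontrivial_proof

/-- STUB 2 (≡ stmt-NavierStokesRegularity-1589 by name; SHARED open crux of route RecurrentProfiles — not to
be worked from this line): the recurrent Liouville theorem. In tree it is certified equivalent to
RecurrentProfiles' target `NoTypeIRateProfile` (stmt-1588) and to RellichScar's
`NoApexTypeIProfile ∧ ApexLocalisation` (stmt-11716 ∧ stmt-11719):
`Theorems.recurrentLiouville_iff_noTypeIRateProfile`, `Theorems.recurrentLiouville_iff_rellichScar`.
[cite: PineauVicol2026; ChaeWolf2017RemovingDSS; Tsai1998; NecasRuzickaSverak1996] -/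
theorem stub_recurrentLiouville : Summit.NavierStokesRegularity.NavierStokesRegularity.Theses.RecurrentProfiles.RecurrentLiouville := by
  sorry

/-- COMPOSITION (kernel-checked, no sorry of its own): the crux BY NAME from the two stubs BY NAME and the
PROVED `recurrentReduction_proof` — pure logic plus `fderiv` of the zero slice. -/
theorem ExtremalBiaxialitySubcritical_of : Summit.NavierStokesRegularity.NavierStokesRegularity.Theses.SqueezeCycle.ExtremalBiaxialitySubcritical := by
  intro C m u t₀ x₀ ht₀ hu hGE _hmax
  -- Step 1: `u` vanishes identically on `t < 0` (else: singular profile → recurrent singular profile → regular: absurd).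
  have hX : ∀ t < 0, ∀ x, u t x = 0 := by
    by_contra hne
    push Not at hne
    obtain ⟨t, ht, x, hx⟩ := hne
    obtain ⟨w, q, H, h1, h2, h3, h4, h5⟩ := stub_singularProfileOfNontrivial C u hu ⟨t, ht, x, hx⟩
    obtain ⟨w', q', H', hw1, hw2, hw3, hw4, hw5, hw6⟩ :=
      Summit.NavierStokesRegularity.NavierStokesRegularity.Theorems.recurrentReduction_proof w q H C h1 h2 h3 h4 h5
    exact stub_recurrentLiouville w' q' H' C hw1 hw2 hw3 hw4 hw6 hw5
  -- Step 2: the record inequality for the zero field reads `m ≤ 0 < 1/8`.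
  obtain ⟨v, w, -, -, -, hq⟩ := hGE
  have h0 : u t₀ = fun _ => (0 : EuclideanSpace ℝ (Fin 3)) := funext (hX t₀ ht₀)
  have h1 := hq 1 0
  rw [h0] at h1
  simp only [fderiv_const_apply] at h1
  norm_num at h1
  linarith

end Summit.NavierStokesRegularity.NavierStokesRegularity.Cruxes.ExtremalBiaxialitySubcritical.RecurrentSingularBridge
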